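import Summits.Ventures.CertifiedManyBodySolver.Downfold.EmeryFermiFilling
import Summits.Ventures.CertifiedManyBodySolver.Downfold.EmeryFermiSurfaceShapeBox
import Literature.Analysis.ValidatedNumerics.TrigLogTables
import HarnessLib

/-!
# The filling ↦ Fermi-energy map of the σ three-band antibonding band, II: the two counting theorems and
# the kernel-checked grid table

Venture CertifiedManyBodySolver, cell `pub/hubbard-downfold` (stage S1), seat hubbard-downfold-mod-4 (technique
B); namespace `Summit.Ventures.CertifiedManyBodySolver.Downfold.Emery`. Everything here is PROVED. WHAT THIS IS
NOT: a statement about any material; no number lives here; `U = 0` band kinematics only.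

With rational enclosures `xl i ≤ sin²(k_i/2) ≤ xh i` of the grid of `EmeryFermiFilling` (`GridEncl`) and
rational bounds `A, D, N` on the three coefficients of the BILINEAR secular function
`charCubic(ε) = cA − 4fsD(x + y) − 16fsN·xy` (`EmeryFermiSurfaceShape.charCubic_bilinear`) valid at the
parameter point:

* §3 `card(innerFlagged)/K² ≤ abFilling(ε)` (`card_innerFlagged_le_abFilling`: cells on which
  `charCubic(ε) > 0` and the Taylor side conditions of `EmeryAntibondingBand.abBand_lt_of_taylor` hold at the
  worst corner lie inside the occupied set; disjoint half-open cells) and `abFilling(ε) ≤ card(outerFlagged)/K²`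
  (`abFilling_le_card_outerFlagged`: cells not excluded by `charCubic(ε) < 0` at the best corner cover the
  occupied set, `le_abBand_of_charCubic_nonpos`). The cards are evaluated by `decide` in consumers; the
  Fermi-energy bracket follows from two counts (`fermiEnergy_mem_Icc_of_abFilling_mem`).
* §4 `halfSqEncl K i` — enclosure of `sin²(k_i/2) = (1 − cos(iπ/K))/2` in the tree's kernel-evaluable
  fixed-point engine (`Literature.Analysis.ValidatedNumerics.Numerics.FI.cosSin`, `FI.pi`) and the boolean
  check `gridEnclCheck` of a rational table against it (`gridEncl_of_check`).

Sources: three-band model [HybertsenSchluterChristensen1989, Eq. (1)]; interval arithmetic [folklore]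
(R. E. Moore, Interval Analysis, 1966, Ch. 2–4).
-/

noncomputable section

namespace Summit.Ventures.CertifiedManyBodySolver.Downfold.Emery

open Real MeasureTheory Set
/-! ## §3 The two counting theorems -/

/-- Lower test function of a cell at its WORST (upper-right) corner: `A − 4D(X + Y) − 16N·XY` with the
enclosures `X = xh (i+1)`, `Y = xh (j+1)`. [folklore] -/
def innerVal (xh : ℕ → ℚ) (A D N : ℚ) (ij : ℕ × ℕ) : ℚ :=
  A - 4 * D * (xh (ij.1 + 1) + xh (ij.2 + 1)) - 16 * N * (xh (ij.1 + 1) * xh (ij.2 + 1))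

/-- Lower bound of the Taylor side condition `3ε² + 2·cubA·ε + cubB` on a cell (worst corner, `cubA ≥ 2Δ₁`,
`cubB ≥ Δ₁² − 16t_pp²xy − 4t_pd²(x + y)`). [folklore] -/
def taylorVal (xh : ℕ → ℚ) (ε Δlo aSqHi bSqHi : ℚ) (ij : ℕ × ℕ) : ℚ :=
  3 * ε ^ 2 + 4 * Δlo * ε + Δlo ^ 2 - 16 * bSqHi * (xh (ij.1 + 1) * xh (ij.2 + 1))
    - 4 * aSqHi * (xh (ij.1 + 1) + xh (ij.2 + 1))

/-- INNER TEST of a cell: certified `ε_AB < ε` on the whole cell. [folklore] -/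
def innerTest (xh : ℕ → ℚ) (ε A D N Δlo aSqHi bSqHi : ℚ) (ij : ℕ × ℕ) : Bool :=
  decide (0 < innerVal xh A D N ij) && decide (0 ≤ taylorVal xh ε Δlo aSqHi bSqHi ij)

/-- The inner-flagged cells. [folklore] -/
def innerFlagged (K : ℕ) (xh : ℕ → ℚ) (ε A D N Δlo aSqHi bSqHi : ℚ) : Finset (ℕ × ℕ) :=
  (Finset.range K ×ˢ Finset.range K).filter fun ij => innerTest xh ε A D N Δlo aSqHi bSqHi ij = true

/-- Upper test function of a cell at its BEST (lower-left) corner: `A − 4D(X + Y) − 16N·XY` with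
`X = xl i`, `Y = xl j`. [folklore] -/
def outerVal (xl : ℕ → ℚ) (A D N : ℚ) (ij : ℕ × ℕ) : ℚ :=
  A - 4 * D * (xl ij.1 + xl ij.2) - 16 * N * (xl ij.1 * xl ij.2)

/-- The outer-flagged cells (those NOT excluded by `charCubic(ε) < 0`). [folklore] -/
def outerFlagged (K : ℕ) (xl : ℕ → ℚ) (A D N : ℚ) : Finset (ℕ × ℕ) :=
  (Finset.range K ×ˢ Finset.range K).filter fun ij => 0 ≤ outerVal xl A D N ij

/-- A rational grid table ENCLOSES the half-angle variable: `0 ≤ xl i ≤ sin²(k_i/2) ≤ xh i` for `i ≤ K`.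
[folklore] -/
def GridEncl (K : ℕ) (xl xh : ℕ → ℚ) : Prop :=
  ∀ i, i ≤ K → 0 ≤ (xl i : ℝ) ∧ (xl i : ℝ) ≤ halfSq (gridPt K i) ∧ halfSq (gridPt K i) ≤ (xh i : ℝ)

/-- The bilinear form `A − 4D(x + y) − 16N·xy` with `D, N ≥ 0` is antitone in `x, y ≥ 0`. [folklore] -/
theorem bilin_antitone {A D N x y X Y : ℝ} (hD : 0 ≤ D) (hN : 0 ≤ N) (hx : 0 ≤ x) (hy : 0 ≤ y)
    (hxX : x ≤ X) (hyY : y ≤ Y) :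
    A - 4 * D * (X + Y) - 16 * N * (X * Y) ≤ A - 4 * D * (x + y) - 16 * N * (x * y) := by
  have hX : 0 ≤ X := hx.trans hxX
  have h1 : x * y ≤ X * Y := mul_le_mul hxX hyY hy hX
  nlinarith

/-- **INNER COUNTING THEOREM.** At a parameter point with `A ≤ cA(ε)`, `fsD(ε) ≤ D`, `fsN(ε) ≤ N` (`D, N ≥ 0`),
`0 ≤ Δ₁ ≤ Δ`, `0 ≤ t_pp′`, `t_pd² ≤ aSqHi`, `t_pp² ≤ bSqHi`, `0 ≤ ε`: every inner-flagged cell lies in the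
occupied set, hence `card(innerFlagged)/K² ≤ abFilling(ε)`. [folklore] -/
theorem card_innerFlagged_le_abFilling {K : ℕ} (hK : 0 < K) {xl xh : ℕ → ℚ} (hG : GridEncl K xl xh)
    {Δ tpd tpp c : ℝ} {ε A D N Δlo aSqHi bSqHi : ℚ}
    (hA : (A : ℝ) ≤ cA Δ ε) (hD : fsD Δ tpd c ε ≤ D) (hN : fsN tpd tpp c ε ≤ N)
    (hD0 : 0 ≤ D) (hN0 : 0 ≤ N) (hΔ : (Δlo : ℝ) ≤ Δ) (hΔ0 : 0 ≤ Δlo) (hc : 0 ≤ c)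
    (ha : tpd ^ 2 ≤ (aSqHi : ℝ)) (hb : tpp ^ 2 ≤ (bSqHi : ℝ)) (hε : 0 ≤ ε) :
    ((innerFlagged K xh ε A D N Δlo aSqHi bSqHi).card : ℝ) / (K : ℝ) ^ 2 ≤ abFilling Δ tpd tpp c ε := by
  set F := innerFlagged K xh ε A D N Δlo aSqHi bSqHi with hF
  have hKr : (0 : ℝ) < K := by exact_mod_cast hK
  have hπ := Real.pi_pos
  have hD0r : (0 : ℝ) ≤ D := by exact_mod_cast hD0
  have hN0r : (0 : ℝ) ≤ N := by exact_mod_cast hN0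
  have hΔlo' : (0 : ℝ) ≤ Δlo := by exact_mod_cast hΔ0
  have hΔnn : 0 ≤ Δ := hΔlo'.trans hΔ
  -- each flagged cell is inside the occupied set
  have hsub : (⋃ ij ∈ F, cellIco K ij) ⊆ abOccSet Δ tpd tpp c ε := by
    intro k hk
    simp only [Set.mem_iUnion, exists_prop] at hk
    obtain ⟨ij, hij, hk⟩ := hk
    rw [hF, innerFlagged, Finset.mem_filter, Finset.mem_product, Finset.mem_range,
      Finset.mem_range] at hij
    obtain ⟨⟨hi, hj⟩, htest⟩ := hij
    simp only [innerTest, Bool.and_eq_true, decide_eq_true_eq] at htest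
    obtain ⟨hval, htay⟩ := htest
    obtain ⟨⟨h1lo, h1hi⟩, ⟨h2lo, h2hi⟩⟩ := hk
    have hi1 : ij.1 + 1 ≤ K := hi
    have hj1 : ij.2 + 1 ≤ K := hj
    have hk1π : k.1 ≤ π := h1hi.le.trans (gridPt_le_pi hK hi1)
    have hk2π : k.2 ≤ π := h2hi.le.trans (gridPt_le_pi hK hj1)
    have hk10 : 0 ≤ k.1 := (gridPt_nonneg K ij.1).trans h1lo
    have hk20 : 0 ≤ k.2 := (gridPt_nonneg K ij.2).trans h2lo
    refine ⟨⟨⟨hk10, hk1π⟩, ⟨hk20, hk2π⟩⟩, ?_⟩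
    -- enclosures of x, y
    set x := halfSq k.1
    set y := halfSq k.2
    have hxX : x ≤ (xh (ij.1 + 1) : ℝ) :=
      (halfSq_mono hk10 h1hi.le (gridPt_le_pi hK hi1)).trans (hG _ hi1).2.2
    have hyY : y ≤ (xh (ij.2 + 1) : ℝ) :=
      (halfSq_mono hk20 h2hi.le (gridPt_le_pi hK hj1)).trans (hG _ hj1).2.2
    have hx0 : 0 ≤ x := halfSq_nonneg _
    have hy0 : 0 ≤ y := halfSq_nonneg _
    have hX0 : 0 ≤ (xh (ij.1 + 1) : ℝ) := hx0.trans hxX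
    have hY0 : 0 ≤ (xh (ij.2 + 1) : ℝ) := hy0.trans hyY
    have hxy : x * y ≤ (xh (ij.1 + 1) : ℝ) * xh (ij.2 + 1) := mul_le_mul hxX hyY hy0 hX0
    -- charCubic(ε) > 0 on the cell
    have hval' : (0 : ℝ) < innerVal xh A D N ij := by exact_mod_cast hval
    simp only [innerVal, Rat.cast_sub, Rat.cast_mul, Rat.cast_add, Rat.cast_ofNat] at hval'
    have hcc : 0 < charCubic Δ tpd tpp c x y ε := by
      rw [charCubic_bilinear]
      have h1 := bilin_antitone (A := (A : ℝ)) hD0r hN0r hx0 hy0 hxX hyY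
      have h2a : 4 * fsD Δ tpd c ε * (x + y) ≤ 4 * (D : ℝ) * (x + y) :=
        mul_le_mul_of_nonneg_right (by linarith) (add_nonneg hx0 hy0)
      have h2b : 16 * fsN tpd tpp c ε * (x * y) ≤ 16 * (N : ℝ) * (x * y) :=
        mul_le_mul_of_nonneg_right (by linarith) (mul_nonneg hx0 hy0)
      linarith
    -- Taylor side conditions
    have htay' : (0 : ℝ) ≤ taylorVal xh ε Δlo aSqHi bSqHi ij := by exact_mod_cast htay
    simp only [taylorVal, Rat.cast_sub, Rat.cast_mul, Rat.cast_add, Rat.cast_pow,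
      Rat.cast_ofNat] at htay'
    have p1 : 0 ≤ 4 * c * x := by positivity
    have p2 : 0 ≤ 4 * c * y := by positivity
    have hcubA : 2 * (Δlo : ℝ) ≤ cubA Δ c x y := by unfold cubA; linarith
    have hcubB : (Δlo : ℝ) ^ 2 - 16 * bSqHi * (xh (ij.1 + 1) * xh (ij.2 + 1))
        - 4 * aSqHi * (xh (ij.1 + 1) + xh (ij.2 + 1)) ≤ cubB Δ tpd tpp c x y := by
      have e0 : cubB Δ tpd tpp c x y =
          (Δ + 4 * c * x) * (Δ + 4 * c * y) - 16 * (tpp ^ 2 * (x * y)) - 4 * (tpd ^ 2 * (x + y)) := by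
        unfold cubB; ring
      have e1 : (Δlo : ℝ) ^ 2 ≤ Δ ^ 2 := pow_le_pow_left₀ hΔlo' hΔ 2
      have e2 : Δ ^ 2 ≤ (Δ + 4 * c * x) * (Δ + 4 * c * y) := by
        have q1 : 0 ≤ Δ * (4 * c * y) := mul_nonneg hΔnn p2
        have q2 : 0 ≤ (4 * c * x) * Δ := mul_nonneg p1 hΔnn
        have q3 : 0 ≤ (4 * c * x) * (4 * c * y) := mul_nonneg p1 p2
        nlinarith
      have e3 : tpp ^ 2 * (x * y) ≤ bSqHi * (xh (ij.1 + 1) * xh (ij.2 + 1)) :=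
        mul_le_mul hb hxy (mul_nonneg hx0 hy0) ((sq_nonneg _).trans hb)
      have e4 : tpd ^ 2 * (x + y) ≤ aSqHi * (xh (ij.1 + 1) + xh (ij.2 + 1)) :=
        mul_le_mul ha (add_le_add hxX hyY) (add_nonneg hx0 hy0) ((sq_nonneg _).trans ha)
      rw [e0]; linarith
    have hεr : (0 : ℝ) ≤ ε := by exact_mod_cast hε
    have h1 : 0 ≤ 3 * (ε : ℝ) ^ 2 + 2 * cubA Δ c x y * ε + cubB Δ tpd tpp c x y := by
      have := mul_le_mul_of_nonneg_right hcubA hεr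
      linarith
    have h2 : 0 ≤ 3 * (ε : ℝ) + cubA Δ c x y := by linarith
    exact (abBand_lt_of_taylor hcc h1 h2).le
  -- measure of the union of flagged cells
  have hvol : volume (⋃ ij ∈ F, cellIco K ij) =
      (F.card : ENNReal) * (ENNReal.ofReal (π / K) * ENNReal.ofReal (π / K)) := by
    rw [measure_biUnion_finset (fun ij _ ij' _ hne => cellIco_disjoint K hne)
      (fun ij _ => measurableSet_cellIco K ij)]
    simp only [volume_cellIco hK, Finset.sum_const, nsmul_eq_mul]
  have hle : (F.card : ENNReal) * (ENNReal.ofReal (π / K) * ENNReal.ofReal (π / K))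
      ≤ volume (abOccSet Δ tpd tpp c ε) := hvol ▸ measure_mono hsub
  -- pass to reals
  have hfin := volume_abOccSet_ne_top Δ tpd tpp c ε
  have hreal : (F.card : ℝ) * (π / K * (π / K)) ≤ (volume (abOccSet Δ tpd tpp c ε)).toReal := by
    have := (ENNReal.toReal_le_toReal (by
      exact ENNReal.mul_ne_top (ENNReal.natCast_ne_top _)
        (ENNReal.mul_ne_top ENNReal.ofReal_ne_top ENNReal.ofReal_ne_top)) hfin).2 hle
    rw [ENNReal.toReal_mul, ENNReal.toReal_mul, ENNReal.toReal_natCast,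
      ENNReal.toReal_ofReal (by positivity)] at this
    exact this
  unfold abFilling
  rw [div_le_div_iff₀ (by positivity) (by positivity)]
  have hKK : (π / K * (π / K)) * (K : ℝ) ^ 2 = π ^ 2 := by field_simp
  calc (F.card : ℝ) * π ^ 2 = (F.card : ℝ) * (π / K * (π / K)) * (K : ℝ) ^ 2 := by
        rw [mul_assoc, hKK]
    _ ≤ (volume (abOccSet Δ tpd tpp c ε)).toReal * (K : ℝ) ^ 2 :=
        mul_le_mul_of_nonneg_right hreal (by positivity)

/-- **OUTER COUNTING THEOREM.** At a parameter point with `cA(ε) ≤ A`, `D ≤ fsD(ε)`, `N ≤ fsN(ε)`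
(`0 ≤ D`, `0 ≤ N`): the occupied set is covered by the outer-flagged closed cells, hence
`abFilling(ε) ≤ card(outerFlagged)/K²`. [folklore] -/
theorem abFilling_le_card_outerFlagged {K : ℕ} (hK : 0 < K) {xl xh : ℕ → ℚ} (hG : GridEncl K xl xh)
    {Δ tpd tpp c : ℝ} {ε A D N : ℚ}
    (hA : cA Δ ε ≤ A) (hD : (D : ℝ) ≤ fsD Δ tpd c ε) (hN : (N : ℝ) ≤ fsN tpd tpp c ε)
    (hD0 : 0 ≤ D) (hN0 : 0 ≤ N) :
    abFilling Δ tpd tpp c ε ≤ ((outerFlagged K xl A D N).card : ℝ) / (K : ℝ) ^ 2 := by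
  set F := outerFlagged K xl A D N with hF
  have hKr : (0 : ℝ) < K := by exact_mod_cast hK
  have hπ := Real.pi_pos
  have hD0r : (0 : ℝ) ≤ D := by exact_mod_cast hD0
  have hN0r : (0 : ℝ) ≤ N := by exact_mod_cast hN0
  -- the occupied set is covered by the flagged closed cells
  have hcov : abOccSet Δ tpd tpp c ε ⊆ ⋃ ij ∈ F, cellIcc K ij := by
    rintro ⟨k1, k2⟩ ⟨⟨⟨h10, h1π⟩, ⟨h20, h2π⟩⟩, hocc⟩
    obtain ⟨i, hi, hi1, hi2⟩ := exists_gridIndex hK h10 h1π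
    obtain ⟨j, hj, hj1, hj2⟩ := exists_gridIndex hK h20 h2π
    simp only [Set.mem_iUnion, exists_prop]
    refine ⟨(i, j), ?_, ⟨⟨hi1, hi2⟩, ⟨hj1, hj2⟩⟩⟩
    -- if the cell were unflagged, `charCubic(ε) < 0` there, contradicting occupancy
    by_contra hnot
    rw [hF, outerFlagged, Finset.mem_filter, Finset.mem_product, Finset.mem_range,
      Finset.mem_range] at hnot
    have hneg : outerVal xl A D N (i, j) < 0 := by
      by_contra hge; exact hnot ⟨⟨hi, hj⟩, not_lt.1 hge⟩
    have hneg' : (outerVal xl A D N (i, j) : ℝ) < 0 := by exact_mod_cast hneg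
    simp only [outerVal, Rat.cast_sub, Rat.cast_mul, Rat.cast_add, Rat.cast_ofNat] at hneg'
    set x := halfSq k1
    set y := halfSq k2
    have hxl : (xl i : ℝ) ≤ x := (hG i hi.le).2.1.trans (halfSq_mono (gridPt_nonneg K i) hi1 h1π)
    have hyl : (xl j : ℝ) ≤ y := (hG j hj.le).2.1.trans (halfSq_mono (gridPt_nonneg K j) hj1 h2π)
    have hxl0 : 0 ≤ (xl i : ℝ) := (hG i hi.le).1
    have hyl0 : 0 ≤ (xl j : ℝ) := (hG j hj.le).1
    have hx0 : 0 ≤ x := halfSq_nonneg _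
    have hy0 : 0 ≤ y := halfSq_nonneg _
    have hcc : charCubic Δ tpd tpp c x y ε < 0 := by
      rw [charCubic_bilinear]
      have h1 := bilin_antitone (A := (A : ℝ)) hD0r hN0r hxl0 hyl0 hxl hyl
      have h2a : 4 * (D : ℝ) * (x + y) ≤ 4 * fsD Δ tpd c ε * (x + y) :=
        mul_le_mul_of_nonneg_right (by linarith) (add_nonneg hx0 hy0)
      have h2b : 16 * (N : ℝ) * (x * y) ≤ 16 * fsN tpd tpp c ε * (x * y) :=
        mul_le_mul_of_nonneg_right (by linarith) (mul_nonneg hx0 hy0)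
      linarith
    have hle : (ε : ℝ) ≤ abBand Δ tpd tpp c x y := le_abBand_of_charCubic_nonpos hcc.le
    have heq : abBand Δ tpd tpp c x y = ε := le_antisymm hocc hle
    have := charCubic_abBand Δ tpd tpp c x y
    rw [heq] at this
    linarith
  -- measure bound
  have hle : volume (abOccSet Δ tpd tpp c ε) ≤
      (F.card : ENNReal) * (ENNReal.ofReal (π / K) * ENNReal.ofReal (π / K)) := by
    calc volume (abOccSet Δ tpd tpp c ε) ≤ volume (⋃ ij ∈ F, cellIcc K ij) := measure_mono hcov
      _ ≤ ∑ ij ∈ F, volume (cellIcc K ij) := measure_biUnion_finset_le F _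
      _ = (F.card : ENNReal) * (ENNReal.ofReal (π / K) * ENNReal.ofReal (π / K)) := by
          simp only [volume_cellIcc hK, Finset.sum_const, nsmul_eq_mul]
  have hreal : (volume (abOccSet Δ tpd tpp c ε)).toReal ≤ (F.card : ℝ) * (π / K * (π / K)) := by
    have hne : (F.card : ENNReal) * (ENNReal.ofReal (π / K) * ENNReal.ofReal (π / K)) ≠ ⊤ :=
      ENNReal.mul_ne_top (ENNReal.natCast_ne_top _)
        (ENNReal.mul_ne_top ENNReal.ofReal_ne_top ENNReal.ofReal_ne_top)
    have := (ENNReal.toReal_le_toReal (volume_abOccSet_ne_top Δ tpd tpp c ε) hne).2 hle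
    rw [ENNReal.toReal_mul, ENNReal.toReal_mul, ENNReal.toReal_natCast,
      ENNReal.toReal_ofReal (by positivity)] at this
    exact this
  unfold abFilling
  rw [div_le_div_iff₀ (by positivity) (by positivity)]
  have hKK : (π / K * (π / K)) * (K : ℝ) ^ 2 = π ^ 2 := by field_simp
  calc (volume (abOccSet Δ tpd tpp c ε)).toReal * (K : ℝ) ^ 2
      ≤ (F.card : ℝ) * (π / K * (π / K)) * (K : ℝ) ^ 2 := mul_le_mul_of_nonneg_right hreal (by positivity)
    _ = (F.card : ℝ) * π ^ 2 := by rw [mul_assoc, hKK]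

/-- **THE FERMI-ENERGY BRACKET FROM TWO COUNTS.** If `abFilling(ε₁) ≤ u < ν₁` and `ν₂ < l ≤ abFilling(ε₂)`,
then every Fermi energy with filling in `[ν₁, ν₂]` lies in `[ε₁, ε₂]` (monotonicity). [folklore] -/
theorem fermiEnergy_mem_Icc_of_abFilling_mem {Δ tpd tpp c ε ε₁ ε₂ ν₁ ν₂ u l : ℝ}
    (h₁ : abFilling Δ tpd tpp c ε₁ ≤ u) (hu : u < ν₁) (h₂ : l ≤ abFilling Δ tpd tpp c ε₂) (hl : ν₂ < l)
    (hν : abFilling Δ tpd tpp c ε ∈ Set.Icc ν₁ ν₂) : ε ∈ Set.Icc ε₁ ε₂ := by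
  obtain ⟨hlo, hhi⟩ := hν
  constructor
  · by_contra h
    have := abFilling_mono Δ tpd tpp c (le_of_not_ge h)
    linarith
  · by_contra h
    have := abFilling_mono Δ tpd tpp c (le_of_not_ge h)
    linarith

/-! ## §4 The grid table certified by the fixed-point engine -/

open Literature.Analysis.ValidatedNumerics.Numerics in
/-- Engine enclosure of `sin²(k_i/2) = (1 − cos(iπ/K))/2`. [folklore] -/
def halfSqEncl (K i : ℕ) : FI :=
  FI.divNat (FI.sub (FI.ofInt 1) (FI.cosSin (FI.divNat (FI.mulInt FI.pi i) K)).1) 2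

open Literature.Analysis.ValidatedNumerics.Numerics in
/-- Soundness of `halfSqEncl`. [folklore] -/
theorem mem_halfSqEncl {K : ℕ} (hK : 0 < K) (i : ℕ) : FI.mem (halfSq (gridPt K i)) (halfSqEncl K i) := by
  have hθ : FI.mem (gridPt K i) (FI.divNat (FI.mulInt FI.pi i) K) := by
    have h1 := FI.mem_mulInt FI.mem_pi (i : ℤ)
    have h2 := FI.mem_divNat h1 hK
    unfold gridPt
    convert h2 using 1
    push_cast; ring
  have hc := (FI.mem_cosSin hθ).1
  have h3 := FI.mem_sub (FI.mem_ofInt 1) hc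
  have h4 := FI.mem_divNat h3 (n := 2) (by norm_num)
  rw [halfSq_eq_cos]
  unfold halfSqEncl
  convert h4 using 1
  push_cast; ring

open Literature.Analysis.ValidatedNumerics.Numerics in
/-- Boolean check of a rational grid table against the engine: `0 ≤ xl i ≤ max(0, lo(encl_i))` and
`min(1, hi(encl_i)) ≤ xh i` for `i = 0, …, K` (the trivial bounds `0 ≤ sin² ≤ 1` absorb the end points). [folklore] -/
def gridEnclCheck (K : ℕ) (xl xh : ℕ → ℚ) : Bool :=
  (List.range (K + 1)).all fun i =>
    decide (0 ≤ xl i) && decide (xl i ≤ max 0 (halfSqEncl K i).loQ) &&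
      decide (min 1 (halfSqEncl K i).hiQ ≤ xh i)

open Literature.Analysis.ValidatedNumerics.Numerics in
/-- **Soundness of the grid check**: `gridEnclCheck = true ⇒ GridEncl`. [folklore] -/
theorem gridEncl_of_check {K : ℕ} (hK : 0 < K) {xl xh : ℕ → ℚ} (h : gridEnclCheck K xl xh = true) :
    GridEncl K xl xh := by
  intro i hi
  rw [gridEnclCheck, List.all_eq_true] at h
  have hi' := h i (List.mem_range.2 (Nat.lt_succ_of_le hi))
  simp only [Bool.and_eq_true, decide_eq_true_eq] at hi'
  obtain ⟨⟨h0, h1⟩, h2⟩ := hi'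
  have hm := mem_halfSqEncl hK i
  refine ⟨by exact_mod_cast h0, ?_, ?_⟩
  · have h1' : (xl i : ℝ) ≤ max (0 : ℝ) ((halfSqEncl K i).loQ : ℝ) := by exact_mod_cast h1
    exact h1'.trans (max_le (halfSq_nonneg _) (FI.loQ_le hm))
  · have h2' : min (1 : ℝ) ((halfSqEncl K i).hiQ : ℝ) ≤ (xh i : ℝ) := by exact_mod_cast h2
    exact (le_min (halfSq_le_one _) (FI.le_hiQ hm)).trans h2' 

end Summit.Ventures.CertifiedManyBodySolver.Downfold.Emery
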